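import Literature.NumberTheory.EllipticCurves.TowerLocalH1LiftExactProofs
import HarnessLib

/-!
# Endomorphisms of an exact tower of finite discrete Galois modules: kernels of `H¹(×π^n)` are killed by
# any endomorphism killing `H⁰` of the cokernel level, and classes of `H¹` lift up the tower after an
# endomorphism killing `H²` (theorems only)

`Proofs` file (theorems only; no definition, no named fact, no instance, no `sorry`).  Topic
`NumberTheory/EllipticCurves` (companion of `TowerLocalH1LiftExactProofs` — same PRESENTED-TOWER currency — and of
`ContinuousCohomologyConnectingNaturality`).  D1 road of cell `pub/bsd-print-x9`: Howard's hypothesis H.5(b) for the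
Eisenstein specialisation at the places `v ∣ p`, the UNIFORM «`ι` on the characteristic-`p` level» road of
`x9-p1-w3` (file plan F1–F7), brick (GEN-COH) = F1b: the `δ₀`/`δ₁` dischargers of the hypotheses (hTor), (LIFT), (F2′)
of the pure tower-algebra theorem F1 (`Tower.map_levelCondition_eq_map_torsionCut`).

**Setting.** A tower of discrete `Γ_F`-modules `W j` presented by ONE two-index family of continuous equivariant
maps `f a b : W a → W b` (reductions for `b ≤ a`, the injections `×π^{b-a}` for `a ≤ b`) with the identities of
`TowerLocalH1LiftExactProofs` (`hid`, `hcomp`, `hinj`, `hsurj`, and exactness `hex` of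
`0 → W ℓ →(f ℓ (ℓ+n)) W (ℓ+n) →(f (ℓ+n) n) W n → 0`), TOGETHER WITH a family of continuous equivariant
ENDOMORPHISMS `s j : W j → W j` commuting with the presentation, `f a b ∘ s a = s b ∘ f a b` (`hfs`) — the intended
instance is the scalar `[T]^r •` on Howard's `π`-adic Eisenstein tower (`scalarIntertwining`).  Then `(s ℓ, s (ℓ+n), s n)`
is an endomorphism of each short exact sequence `0 → W ℓ → W (ℓ+n) → W n → 0`, and the NATURALITY of the connecting
maps `δ₀`, `δ₁` (`IsSES.cohomologyMap_δ₀`, `IsSES.cohomologyMap_δ₁`) combined with the exactness of the long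
cohomology sequence (`ContinuousCohomologyConnecting`) gives:

* §1 (one short exact sequence `0 → P →(i) M →(q) G → 0` of discrete `Γ`-modules, `Γ` locally compact, with a
  commuting endomorphism `(φ_P, φ_M, φ_G)`):
  `cohomologyMap_one_eq_zero_of_map_eq_zero_of_invariants` — **if `φ_G` kills `G^Γ` then `H¹(φ_P)` kills
  `ker (H¹(P) → H¹(M)) = δ₀(G^Γ)`**; `exists_cohomologyMap_one_eq_of_cohomologyMap_two_eq_zero` — **if `H²(φ_P) = 0`
  on `H²(Γ, P)` then `H¹(φ_G) w` lifts to `H¹(Γ, M)` for every `w ∈ H¹(Γ, G)`** (`δ₁(H¹(φ_G) w) = H²(φ_P)(δ₁ w) = 0`).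
* §2 (the presented tower, `galoisCohomology.map` currency):
  `map_endo_eq_zero_of_map_up_eq_zero` (T1) — **`H¹(f ℓ (ℓ+n)) w = 0` and `s n` kills `H⁰(Γ_F, W n)` ⇒
  `H¹(s ℓ) w = 0`** (`ker H¹(×π^n) = δ₀ H⁰(W n)`); the family form `forall_map_endo_eq_zero_of_forall_map_up_eq_zero`
  (T2: a family `w` killed levelwise by `H¹(×π^d)` is killed by the `H¹(s j)` once `s d` kills `H⁰(W d)` — the
  (hTor) shape); `exists_map_down_eq_map_endo` (T3) — **if `H²(s i) = 0` on every `H²(Γ_F, W i)` then for all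
  `N n` and `y ∈ H¹(W N)` there is `z ∈ H¹(W (n+N))` with `H¹(f (n+N) N) z = H¹(s N) y`** («`s y` lifts `n` levels»);
  and, with finiteness of the `H¹(Γ_F, W j)` (Kőnig, `exists_mem_compatibleFamilies_of_forall_mem_of_le`),
  `exists_mem_compatibleFamilies_apply_eq_map_endo` (T3∞) — **`H¹(s N) y` is the `N`-component of a COMPATIBLE family**
  (the (LIFT) shape «`π^{c'} y` lifts to every level»).
* §3 the same in SCALAR currency (`IsScalarLinear`, `scalarIntertwining`, `scalarMapH1`/`scalarMap … 2`) for a scalar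
  `r` commuting with the presentation (`f a b (r • x) = r • f a b x`): `scalarMapH1_eq_zero_of_map_up_eq_zero`,
  `exists_map_down_eq_scalarMapH1`, `exists_mem_compatibleFamilies_apply_eq_scalarMapH1`.

Why (the uniform road): at an ANOMALOUS place `v ∣ p` the graded pieces `gr_v W_j` have non-zero `Γ_{K_v}`-invariants
and `H²(K_v, Fil_v W_j) ≠ 0`, so the non-anomalous inputs «`H⁰ = 0`» / «`H² = 0`» of the tree's (B1)/(C1) lemmas
(`map_quotFamily_injective_of_forall_invariant_eq_zero`, `map_subFamily_surjective_of_subsingleton`) fail; but both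
groups are killed by a FIXED power `[T]^r` of the uniformiser (`ZpExtensionEisensteinOrdinaryInvariantsBoundProofs`),
and the quantitative statements of this file are what replaces them.

References: J.-P. Serre, *Galois Cohomology* (1997), I §2.2–2.3 (long exact sequence, functorial in morphisms of
short exact sequences); Neukirch–Schmidt–Wingberg, *Cohomology of Number Fields* (2008), (1.3.2)–(1.3.3); B. Howard,
Compositio Math. 140 (2004), §1.6 and Lemma 3.2.7 (arXiv:1202.6340 p. 12 L29–55: the exact `𝔪`-adic tower), H.5(b)
(p. 7 L93–97).  No summit statement is proved; BSD is not proved by any of this.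
-/

noncomputable section

open CategoryTheory
open scoped ContRepresentation
universe u

namespace Literature.NumberTheory.EllipticCurves

namespace Tower

open Literature.NumberTheory.GaloisRepresentations

/-! ## §1 One short exact sequence with a commuting endomorphism -/

section OneSES

variable {Γ : Type u} [Group Γ] [TopologicalSpace Γ] [IsTopologicalGroup Γ] [LocallyCompactSpace Γ]
variable {M₁ : Type u} [AddCommGroup M₁] [TopologicalSpace M₁] [DiscreteTopology M₁]
variable {M₂ : Type u} [AddCommGroup M₂] [TopologicalSpace M₂] [DiscreteTopology M₂]
variable {M₃ : Type u} [AddCommGroup M₃] [TopologicalSpace M₃] [DiscreteTopology M₃]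
variable {ρ₁ : ContinuousRep Γ ℤ M₁} {ρ₂ : ContinuousRep Γ ℤ M₂} {ρ₃ : ContinuousRep Γ ℤ M₃}
variable {i : ρ₁.toTopRep ⟶ ρ₂.toTopRep} {q : ρ₂.toTopRep ⟶ ρ₃.toTopRep}
variable {φ₁ : ρ₁.toTopRep ⟶ ρ₁.toTopRep} {φ₂ : ρ₂.toTopRep ⟶ ρ₂.toTopRep} {φ₃ : ρ₃.toTopRep ⟶ ρ₃.toTopRep}

omit [LocallyCompactSpace Γ] in
/-- **An endomorphism of a short exact sequence killing the invariants of the cokernel kills `ker H¹(i)`.**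
For `0 → M₁ →(i) M₂ →(q) M₃ → 0` exact and a commuting endomorphism `(φ₁, φ₂, φ₃)` with `φ₃ = 0` on `M₃^Γ`:
`H¹(i) w = 0 ⇒ H¹(φ₁) w = 0` — because `w = δ₀ v` (exactness at `H¹(Γ, M₁)`) and `H¹(φ₁)(δ₀ v) = δ₀(φ₃ v) = 0`
(naturality of `δ₀`). [cite: SerreGaloisCohomology1997, Ch. I §2.2 (cohomology exact sequence, functorial)]
[cite: NeukirchSchmidtWingberg2008, (1.3.2)–(1.3.3)] -/
theorem cohomologyMap_one_eq_zero_of_map_eq_zero_of_invariants (h : IsSES i q)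
    (hsq₁ : ∀ x, φ₂.hom (i.hom x) = i.hom (φ₁.hom x)) (hsq₂ : ∀ y, φ₃.hom (q.hom y) = q.hom (φ₂.hom y))
    (hinv : ∀ v : M₃, v ∈ ρ₃.toTopRep.ρ.invariants → φ₃.hom v = 0)
    (w : continuousCohomology 1 ρ₁.toTopRep) (hw : cohomologyMap i 1 w = 0) :
    cohomologyMap φ₁ 1 w = 0 := by
  obtain ⟨v, rfl⟩ := h.exists_δ₀_eq_of_map_one_eq_zero w hw
  rw [IsSES.cohomologyMap_δ₀ h h hsq₁ hsq₂ v]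
  have h0 : (⟨φ₃.hom (v : M₃), IsSES.mem_invariants_map hsq₂ v⟩ : ρ₃.toTopRep.ρ.invariants) = 0 :=
    Subtype.ext (hinv v v.2)
  rw [h0, map_zero]

/-- **An endomorphism of a short exact sequence killing `H²` of the kernel makes `H¹(φ₃)` liftable.**
For `0 → M₁ →(i) M₂ →(q) M₃ → 0` exact and a commuting endomorphism `(φ₁, φ₂, φ₃)` with `H²(φ₁) = 0` on
`H²(Γ, M₁)`: every `H¹(φ₃) w`, `w ∈ H¹(Γ, M₃)`, is `H¹(q) z` for some `z ∈ H¹(Γ, M₂)` — because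
`δ₁(H¹(φ₃) w) = H²(φ₁)(δ₁ w) = 0` (naturality of `δ₁`) and exactness at `H¹(Γ, M₃)`.
[cite: SerreGaloisCohomology1997, Ch. I §2.2–2.3] [cite: NeukirchSchmidtWingberg2008, (1.3.2)–(1.3.3)] -/
theorem exists_cohomologyMap_one_eq_of_cohomologyMap_two_eq_zero (h : IsSES i q)
    (hsq₁ : ∀ x, φ₂.hom (i.hom x) = i.hom (φ₁.hom x)) (hsq₂ : ∀ y, φ₃.hom (q.hom y) = q.hom (φ₂.hom y))
    (h2 : ∀ z : continuousCohomology 2 ρ₁.toTopRep, cohomologyMap φ₁ 2 z = 0)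
    (w : continuousCohomology 1 ρ₃.toTopRep) :
    ∃ z : continuousCohomology 1 ρ₂.toTopRep, cohomologyMap q 1 z = cohomologyMap φ₃ 1 w := by
  apply h.exists_map_one_eq_of_δ₁_eq_zero
  rw [← IsSES.cohomologyMap_δ₁ h h hsq₁ hsq₂ w, h2]

end OneSES

/-! ## §2 The presented tower with a commuting endomorphism family -/

variable {F : Type u} [Field F]
variable {W : ℕ → Type u} [∀ j, AddCommGroup (W j)] [∀ j, TopologicalSpace (W j)]
  [∀ j, DiscreteTopology (W j)]
variable (ρ : ∀ j, DiscreteGaloisModule F (W j))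
variable (f : ∀ a b, (ρ a).toContRepresentation →ⁱL (ρ b).toContRepresentation)

/-- `galoisCohomology.map g 2` is the tree's `cohomologyMap` of the `TopRep` morphism underlying `g`, in degree `2`
(definitionally; degree-`1` twin: `galoisCohomology.map_eq_cohomologyMap_apply`). [cite: SerreGaloisCohomology1997, Ch. I §2.2] -/
theorem map_two_eq_cohomologyMap_apply {M N : Type u} [AddCommGroup M] [TopologicalSpace M] [DiscreteTopology M]
    [AddCommGroup N] [TopologicalSpace N] [DiscreteTopology N] {τ : DiscreteGaloisModule F M}
    {τ' : DiscreteGaloisModule F N} (g : τ.toContRepresentation →ⁱL τ'.toContRepresentation)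
    (c : galoisCohomology τ 2) :
    galoisCohomology.map g 2 c =
      (cohomologyMap (TopRep.ofHom ⟨g.toContinuousLinearMap, g.isIntertwining'⟩ : τ.toTopRep ⟶ τ'.toTopRep) 2).hom
        c := rfl

/-- **(T1) `ker H¹(×π^n)` is killed by every endomorphism killing `H⁰(Γ_F, W n)`.**  For the exact presented tower
and a commuting endomorphism family `s` (`f a b ∘ s a = s b ∘ f a b`): if `H¹(f ℓ (ℓ+n)) w = 0` and `s n` vanishes on
the `Γ_F`-invariants of `W n`, then `H¹(s ℓ) w = 0` — `w ∈ ker H¹(f ℓ (ℓ+n)) = δ₀ H⁰(W n)` for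
`0 → W ℓ → W (ℓ+n) → W n → 0`, and `H¹(s ℓ) ∘ δ₀ = δ₀ ∘ s n` (naturality).  Intended instance: `s = [T]^r •` on the
`π`-adic Eisenstein tower at a place `v ∣ p`, where `[T]^r` kills the invariants of every graded level.
[cite: SerreGaloisCohomology1997, Ch. I §2.2] [cite: Howard2004HeegnerKolyvagin, §1.6 (arXiv p. 12 L29–55) and §1.3 H.5(b)] -/
theorem map_endo_eq_zero_of_map_up_eq_zero (hinj : ∀ ℓ n, Function.Injective (f ℓ (ℓ + n)))
    (hsurj : ∀ ℓ n, Function.Surjective (f (ℓ + n) n))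
    (hex : ∀ ℓ n (y : W (ℓ + n)), f (ℓ + n) n y = 0 ↔ ∃ x, f ℓ (ℓ + n) x = y)
    (s : ∀ j, (ρ j).toContRepresentation →ⁱL (ρ j).toContRepresentation)
    (hfs : ∀ a b (x : W a), f a b (s a x) = s b (f a b x))
    (ℓ n : ℕ) (hinv : ∀ x : W n, x ∈ (ρ n).toTopRep.ρ.invariants → s n x = 0)
    (w : galoisCohomology (ρ ℓ) 1) (hw : galoisCohomology.map (f ℓ (ℓ + n)) 1 w = 0) :
    galoisCohomology.map (s ℓ) 1 w = 0 := by
  have h := cohomologyMap_one_eq_zero_of_map_eq_zero_of_invariants (isSES_of_exact ρ f hinj hsurj hex ℓ n)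
    (φ₁ := TopRep.ofHom ⟨(s ℓ).toContinuousLinearMap, (s ℓ).isIntertwining'⟩)
    (φ₂ := TopRep.ofHom ⟨(s (ℓ + n)).toContinuousLinearMap, (s (ℓ + n)).isIntertwining'⟩)
    (φ₃ := TopRep.ofHom ⟨(s n).toContinuousLinearMap, (s n).isIntertwining'⟩)
    (fun x ↦ (hfs ℓ (ℓ + n) x).symm) (fun y ↦ (hfs (ℓ + n) n y).symm) hinv w
    (by rw [← galoisCohomology.map_eq_cohomologyMap_apply]; exact hw)
  rw [galoisCohomology.map_eq_cohomologyMap_apply]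
  exact h

/-- **(T2) the family form of (T1)** (the (hTor) shape of the uniform road): if `s d` kills `H⁰(Γ_F, W d)` for every
`d`, then a family `w` of classes killed levelwise by some `H¹(f j (j+d))` (`×π^d`) is killed by the `H¹(s j)`.
[cite: SerreGaloisCohomology1997, Ch. I §2.2] [cite: Howard2004HeegnerKolyvagin, §1.6 and §1.3 H.5(b)] -/
theorem forall_map_endo_eq_zero_of_forall_map_up_eq_zero (hinj : ∀ ℓ n, Function.Injective (f ℓ (ℓ + n)))
    (hsurj : ∀ ℓ n, Function.Surjective (f (ℓ + n) n))
    (hex : ∀ ℓ n (y : W (ℓ + n)), f (ℓ + n) n y = 0 ↔ ∃ x, f ℓ (ℓ + n) x = y)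
    (s : ∀ j, (ρ j).toContRepresentation →ⁱL (ρ j).toContRepresentation)
    (hfs : ∀ a b (x : W a), f a b (s a x) = s b (f a b x))
    (hinv : ∀ d (x : W d), x ∈ (ρ d).toTopRep.ρ.invariants → s d x = 0)
    (w : Π j, galoisCohomology (ρ j) 1) (hw : ∃ d, ∀ j, galoisCohomology.map (f j (j + d)) 1 (w j) = 0) (j : ℕ) :
    galoisCohomology.map (s j) 1 (w j) = 0 := by
  obtain ⟨d, hd⟩ := hw
  exact map_endo_eq_zero_of_map_up_eq_zero ρ f hinj hsurj hex s hfs j d (hinv d) (w j) (hd j)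

/-- **(T3) classes lift `n` levels after an endomorphism killing `H²`.**  For the exact presented tower and a
commuting endomorphism family `s` with `H²(s i) = 0` on every `H²(Γ_F, W i)`: for all `N n` and `y ∈ H¹(Γ_F, W N)`
there is `z ∈ H¹(Γ_F, W (n+N))` with `H¹(f (n+N) N) z = H¹(s N) y` — the obstruction `δ₁ (H¹(s N) y) = H²(s n)(δ₁ y)`
to lifting along `0 → W n → W (n+N) → W N → 0` vanishes.  Intended instance: `s = [T]^c •`, `[T]^c` killing the `H²`
of the ordinary filtration pieces at `v ∣ p`. [cite: SerreGaloisCohomology1997, Ch. I §2.2–2.3]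
[cite: Howard2004HeegnerKolyvagin, §1.6 (arXiv p. 12 L29–55) and §1.3 H.5(b)] -/
theorem exists_map_down_eq_map_endo (hinj : ∀ ℓ n, Function.Injective (f ℓ (ℓ + n)))
    (hsurj : ∀ ℓ n, Function.Surjective (f (ℓ + n) n))
    (hex : ∀ ℓ n (y : W (ℓ + n)), f (ℓ + n) n y = 0 ↔ ∃ x, f ℓ (ℓ + n) x = y)
    (s : ∀ j, (ρ j).toContRepresentation →ⁱL (ρ j).toContRepresentation)
    (hfs : ∀ a b (x : W a), f a b (s a x) = s b (f a b x))
    (h2 : ∀ i (z : galoisCohomology (ρ i) 2), galoisCohomology.map (s i) 2 z = 0)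
    (N n : ℕ) (y : galoisCohomology (ρ N) 1) :
    ∃ z : galoisCohomology (ρ (n + N)) 1,
      galoisCohomology.map (f (n + N) N) 1 z = galoisCohomology.map (s N) 1 y := by
  haveI : CompactSpace (Field.absoluteGaloisGroup F) := absoluteGaloisGroup_compactSpace F
  obtain ⟨z, hz⟩ := exists_cohomologyMap_one_eq_of_cohomologyMap_two_eq_zero
    (isSES_of_exact ρ f hinj hsurj hex n N)
    (φ₁ := TopRep.ofHom ⟨(s n).toContinuousLinearMap, (s n).isIntertwining'⟩)
    (φ₂ := TopRep.ofHom ⟨(s (n + N)).toContinuousLinearMap, (s (n + N)).isIntertwining'⟩)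
    (φ₃ := TopRep.ofHom ⟨(s N).toContinuousLinearMap, (s N).isIntertwining'⟩)
    (fun x ↦ (hfs n (n + N) x).symm) (fun y ↦ (hfs (n + N) N y).symm)
    (fun z ↦ by rw [← map_two_eq_cohomologyMap_apply]; exact h2 n z) y
  refine ⟨z, ?_⟩
  rw [galoisCohomology.map_eq_cohomologyMap_apply, galoisCohomology.map_eq_cohomologyMap_apply]
  exact hz

/-- **(T3∞) … hence `H¹(s N) y` is the `N`-component of a COMPATIBLE family** of `lim_j H¹(Γ_F, W_j)` (finite
`H¹`'s: the sets of level-`j` lifts of `H¹(s N) y` are finite, nonempty by (T3) and reduction-stable; Kőnig) — the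
(LIFT) shape «`π^{c'} y` lifts to every level» of the uniform road. [cite: SerreGaloisCohomology1997, Ch. I §2.2–2.3]
[cite: Howard2004HeegnerKolyvagin, §1.6 and Lemma 3.2.7 (arXiv p. 12, p. 16)] -/
theorem exists_mem_compatibleFamilies_apply_eq_map_endo [∀ j, Finite (galoisCohomology (ρ j) 1)]
    (hid : ∀ a (w : W a), f a a w = w)
    (hcomp : ∀ a b c, c ≤ b → b ≤ a → ∀ w : W a, f b c (f a b w) = f a c w)
    (hinj : ∀ ℓ n, Function.Injective (f ℓ (ℓ + n)))
    (hsurj : ∀ ℓ n, Function.Surjective (f (ℓ + n) n))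
    (hex : ∀ ℓ n (y : W (ℓ + n)), f (ℓ + n) n y = 0 ↔ ∃ x, f ℓ (ℓ + n) x = y)
    (s : ∀ j, (ρ j).toContRepresentation →ⁱL (ρ j).toContRepresentation)
    (hfs : ∀ a b (x : W a), f a b (s a x) = s b (f a b x))
    (h2 : ∀ i (z : galoisCohomology (ρ i) 2), galoisCohomology.map (s i) 2 z = 0)
    (N : ℕ) (y : galoisCohomology (ρ N) 1) :
    ∃ x ∈ compatibleFamilies (H := fun j ↦ galoisCohomology (ρ j) 1)
        (fun j ↦ galoisCohomology.map (f (j + 1) j) 1),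
      x N = galoisCohomology.map (s N) 1 y := by
  have hne : ∀ j, N ≤ j →
      ({Y : galoisCohomology (ρ j) 1 |
        N ≤ j → galoisCohomology.map (f j N) 1 Y = galoisCohomology.map (s N) 1 y}).Nonempty := by
    intro j hj
    obtain ⟨n, rfl⟩ := Nat.exists_eq_add_of_le' hj
    obtain ⟨z, hz⟩ := exists_map_down_eq_map_endo ρ f hinj hsurj hex s hfs h2 N n y
    exact ⟨z, fun _ ↦ hz⟩
  have hst : ∀ j, N ≤ j →
      ∀ Y ∈ {Y : galoisCohomology (ρ (j + 1)) 1 |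
          N ≤ j + 1 → galoisCohomology.map (f (j + 1) N) 1 Y = galoisCohomology.map (s N) 1 y},
        galoisCohomology.map (f (j + 1) j) 1 Y ∈
          {Y : galoisCohomology (ρ j) 1 |
            N ≤ j → galoisCohomology.map (f j N) 1 Y = galoisCohomology.map (s N) 1 y} := by
    intro j hj Y hY _
    rw [Set.mem_setOf_eq] at hY
    rw [galoisCohomology.map_map_of_comp_apply (f (j + 1) j) (f j N) (f (j + 1) N)
      (fun v ↦ (hcomp _ _ _ hj (Nat.le_succ j) v).symm)]
    exact hY (hj.trans (Nat.le_succ j))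
  obtain ⟨x, hx, hxS⟩ := exists_mem_compatibleFamilies_of_forall_mem_of_le
    (H := fun j ↦ galoisCohomology (ρ j) 1) (fun j ↦ galoisCohomology.map (f (j + 1) j) 1) N
    (fun j ↦ {Y | N ≤ j → galoisCohomology.map (f j N) 1 Y = galoisCohomology.map (s N) 1 y}) hne hst
  exact ⟨x, hx, (map_apply_eq_self_of_forall_apply_eq (f N N) (hid N) (x N)).symm.trans (hxS N le_rfl le_rfl)⟩

/-! ## §3 Scalar currency -/

/-- **(T1), scalar form.**  For `R`-linear levels (`IsScalarLinear`) and a scalar `r` commuting with the presentation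
(`f a b (r • x) = r • f a b x`): if `H¹(f ℓ (ℓ+n)) w = 0` and `r` kills the `Γ_F`-invariants of `W n`, then
`H¹(r•) w = 0` (`scalarMapH1`). [cite: SerreGaloisCohomology1997, Ch. I §2.2] [cite: Howard2004HeegnerKolyvagin, §1.6 and §1.3 H.5(b)] -/
theorem scalarMapH1_eq_zero_of_map_up_eq_zero {R : Type*} [Ring R] [∀ j, Module R (W j)]
    (hρ : ∀ j, (ρ j).IsScalarLinear R)
    (hinj : ∀ ℓ n, Function.Injective (f ℓ (ℓ + n)))
    (hsurj : ∀ ℓ n, Function.Surjective (f (ℓ + n) n))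
    (hex : ∀ ℓ n (y : W (ℓ + n)), f (ℓ + n) n y = 0 ↔ ∃ x, f ℓ (ℓ + n) x = y)
    (r : R) (hr : ∀ a b (x : W a), f a b (r • x) = r • f a b x)
    (ℓ n : ℕ) (hinv : ∀ x : W n, x ∈ (ρ n).toTopRep.ρ.invariants → r • x = 0)
    (w : galoisCohomology (ρ ℓ) 1) (hw : galoisCohomology.map (f ℓ (ℓ + n)) 1 w = 0) :
    galoisCohomology.scalarMapH1 (ρ ℓ) (hρ ℓ) r w = 0 :=
  map_endo_eq_zero_of_map_up_eq_zero ρ f hinj hsurj hex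
    (fun j ↦ DiscreteGaloisModule.scalarIntertwining (ρ j) (hρ j) r)
    (fun a b x ↦ by rw [DiscreteGaloisModule.scalarIntertwining_apply, DiscreteGaloisModule.scalarIntertwining_apply]
                    exact hr a b x)
    ℓ n (fun x hx ↦ by rw [DiscreteGaloisModule.scalarIntertwining_apply]; exact hinv x hx) w hw

/-- **(T3), scalar form.**  If `H²(r•) = 0` on every `H²(Γ_F, W i)` (`scalarMap … 2 r`) for a scalar `r` commuting
with the presentation, then `H¹(r•) y` lifts `n` levels: `∃ z, H¹(f (n+N) N) z = H¹(r•) y`.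
[cite: SerreGaloisCohomology1997, Ch. I §2.2–2.3] [cite: Howard2004HeegnerKolyvagin, §1.6 and §1.3 H.5(b)] -/
theorem exists_map_down_eq_scalarMapH1 {R : Type*} [Ring R] [∀ j, Module R (W j)]
    (hρ : ∀ j, (ρ j).IsScalarLinear R)
    (hinj : ∀ ℓ n, Function.Injective (f ℓ (ℓ + n)))
    (hsurj : ∀ ℓ n, Function.Surjective (f (ℓ + n) n))
    (hex : ∀ ℓ n (y : W (ℓ + n)), f (ℓ + n) n y = 0 ↔ ∃ x, f ℓ (ℓ + n) x = y)
    (r : R) (hr : ∀ a b (x : W a), f a b (r • x) = r • f a b x)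
    (h2 : ∀ i (z : galoisCohomology (ρ i) 2), galoisCohomology.scalarMap (ρ i) (hρ i) 2 r z = 0)
    (N n : ℕ) (y : galoisCohomology (ρ N) 1) :
    ∃ z : galoisCohomology (ρ (n + N)) 1,
      galoisCohomology.map (f (n + N) N) 1 z = galoisCohomology.scalarMapH1 (ρ N) (hρ N) r y :=
  exists_map_down_eq_map_endo ρ f hinj hsurj hex
    (fun j ↦ DiscreteGaloisModule.scalarIntertwining (ρ j) (hρ j) r)
    (fun a b x ↦ by rw [DiscreteGaloisModule.scalarIntertwining_apply, DiscreteGaloisModule.scalarIntertwining_apply]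
                    exact hr a b x)
    h2 N n y

/-- **(T3∞), scalar form**: `H¹(r•) y` is the `N`-component of a compatible family of `lim_j H¹(Γ_F, W_j)` (finite
`H¹`'s). [cite: SerreGaloisCohomology1997, Ch. I §2.2–2.3] [cite: Howard2004HeegnerKolyvagin, §1.6 and Lemma 3.2.7] -/
theorem exists_mem_compatibleFamilies_apply_eq_scalarMapH1 {R : Type*} [Ring R] [∀ j, Module R (W j)]
    [∀ j, Finite (galoisCohomology (ρ j) 1)] (hρ : ∀ j, (ρ j).IsScalarLinear R)
    (hid : ∀ a (w : W a), f a a w = w)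
    (hcomp : ∀ a b c, c ≤ b → b ≤ a → ∀ w : W a, f b c (f a b w) = f a c w)
    (hinj : ∀ ℓ n, Function.Injective (f ℓ (ℓ + n)))
    (hsurj : ∀ ℓ n, Function.Surjective (f (ℓ + n) n))
    (hex : ∀ ℓ n (y : W (ℓ + n)), f (ℓ + n) n y = 0 ↔ ∃ x, f ℓ (ℓ + n) x = y)
    (r : R) (hr : ∀ a b (x : W a), f a b (r • x) = r • f a b x)
    (h2 : ∀ i (z : galoisCohomology (ρ i) 2), galoisCohomology.scalarMap (ρ i) (hρ i) 2 r z = 0)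
    (N : ℕ) (y : galoisCohomology (ρ N) 1) :
    ∃ x ∈ compatibleFamilies (H := fun j ↦ galoisCohomology (ρ j) 1)
        (fun j ↦ galoisCohomology.map (f (j + 1) j) 1),
      x N = galoisCohomology.scalarMapH1 (ρ N) (hρ N) r y :=
  exists_mem_compatibleFamilies_apply_eq_map_endo ρ f hid hcomp hinj hsurj hex
    (fun j ↦ DiscreteGaloisModule.scalarIntertwining (ρ j) (hρ j) r)
    (fun a b x ↦ by rw [DiscreteGaloisModule.scalarIntertwining_apply, DiscreteGaloisModule.scalarIntertwining_apply]
                    exact hr a b x)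
    h2 N y

end Tower

end Literature.NumberTheory.EllipticCurves

end
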